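import Summits.ABC.ABC.Theses.IsogenyGlueCongruence
import HarnessLib

/-!
# Route IsogenyGlueCongruence — support item `DegreePrimesOfCongruenceBound` (stmt-ABC-14897)

The K-line layer-2 glue of route `IsogenyGlueCongruence`:

> `TorsionSharingPrimeBound → DegreePrimeCongruence → DegreePrimesPolyBounded`.

Given a semistable, globally minimal `W` of conductor `N = W.conductorNorm ℤ ≥ 1`, the congruence
item supplies a parametrisation datum `D` such that every prime `ℓ ∣ deg D` is either `≤ 163` or a
congruence prime of `f_W` with a newform `g` of some level `M ∣ N`, in exactly the hypothesis shape
of the torsion-sharing bound `K = TorsionSharingPrimeBound`.  From `K` take absolute `κ ≥ 0`, `C`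
and put `κ_A := 2κ`, `C_A := max C 0 + 163`.  In the first case `ℓ ≤ 163 ≤ C_A · N ^ (2κ)` since
`N ≥ 1` (`Real.one_le_rpow`); in the second `K` gives `ℓ ≤ C · (M · N) ^ κ ≤ max C 0 · (N · N) ^ κ
= max C 0 · N ^ (2κ) ≤ C_A · N ^ (2κ)` (`M ≤ N` from `M ∣ N`, `Real.rpow_le_rpow`, `Real.rpow_mul`,
`Real.rpow_two`).  Pure bookkeeping; no literature input.  Closes `--workitem stmt-ABC-14897`.

Maintenance record (full-build repair, 2026-08-16). After `degreePrimesOfCongruenceBound_proof`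
closed stmt-ABC-14897 `proved` at 3df8881cdf11, route rev 18 (2026-08-16T14:44:06Z, right-size)
dropped the Theses decls `DegreePrimesOfCongruenceBound` (stmt-ABC-14897) and `DegreePrimeCongruence`
(stmt-ABC-14828) from the gate-written `Summits/ABC/ABC/Theses/IsogenyGlueCongruence.lean`, while
this append-only file still names the former ("Unknown identifier" in the full build of
2026-08-16T19:45Z).  The dropped constant is therefore re-declared below under its original
fully-qualified name (NOT a route item), with the likewise dropped `DegreePrimeCongruence` written
out verbatim inside its definiens rather than re-declared as a second constant — sibling Theorems
files of the `K`-line name `…Theses.IsogenyGlueCongruence.DegreePrimeCongruence` themselves and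
must stay free to restore it upstream of `…DegreePrimeCongruenceOfMazurKenku.lean`, which imports
this module.  The theorem, its name, its statement text and its proof script are unchanged.
-/

-- `Summit.<Summit>.<Problem>` is the mandated summit-side namespace (CONVENTIONS §2); for the
-- single-conjunct summit `ABC` the two coincide, so the duplicate `ABC.ABC` is deliberate.
set_option linter.dupNamespace false

namespace Summit.ABC.ABC.Theses.IsogenyGlueCongruence

/-- **Record of the dropped route item `DegreePrimesOfCongruenceBound`** = stmt-ABC-14897 (closed
`proved` by `Summit.ABC.ABC.Theorems.degreePrimesOfCongruenceBound_proof` below at 3df8881cdf11,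
then dropped from the route file at rev 18, 2026-08-16T14:44:06Z; NOT a route item): the layer-2
glue of the `K`-line, `TorsionSharingPrimeBound → DegreePrimeCongruence → DegreePrimesPolyBounded`,
re-declared under its original fully-qualified name solely so that this append-only record keeps
elaborating.  The middle hypothesis is the ledger signature of the (also dropped) support item
`DegreePrimeCongruence` = stmt-ABC-14828 written out verbatim: every semistable globally minimal
`W` of conductor `N` has a modular parametrisation datum `D` at level `N` such that every prime
`ℓ ∣ deg D` is `≤ 163` or a congruence prime of `f_W` with a newform `g` of some level `M ∣ N`
(`IsNewform0 g ∧ ¬ IsNewformOf W g`, a subring `R ⊂ ℂ` containing all `a_n(g)`, a field `F` of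
characteristic `ℓ` and `φ : R →+* F` with `φ (a_p g) = a_p W` for all primes `p ∤ M·N·ℓ`). -/
def DegreePrimesOfCongruenceBound : Prop :=
  TorsionSharingPrimeBound → (∀ (W : WeierstrassCurve ℚ) [W.IsElliptic] [W.IsGloballyMinimal] [NeZero (W.conductorNorm ℤ)], W.IsSemistable ℤ → ∃ D : Literature.NumberTheory.EllipticCurves.ModularForms.ModularParametrizationData W (W.conductorNorm ℤ), ∀ ℓ : ℕ, ℓ.Prime → ℓ ∣ D.modularDegree → ℓ ≤ 163 ∨ ∃ (M : ℕ) (_ : NeZero M) (g : CuspForm (CongruenceSubgroup.Gamma0 M) 2), M ∣ W.conductorNorm ℤ ∧ Literature.NumberTheory.EllipticCurves.ModularForms.IsNewform0 g ∧ ¬ Literature.NumberTheory.EllipticCurves.ModularForms.IsNewformOf W g ∧ ∃ (R : Subring ℂ) (F : Type) (_ : Field F) (_ : CharP F ℓ) (φ : R →+* F) (hg : ∀ n : ℕ, Literature.NumberTheory.EllipticCurves.ModularForms.cuspCoeff g n ∈ R), ∀ p : ℕ, p.Prime → ¬ (p ∣ M * W.conductorNorm ℤ * ℓ) → φ ⟨Literature.NumberTheory.EllipticCurves.ModularForms.cuspCoeff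 g p, hg p⟩ = ((W.LFunction p : ℤ) : F)) → DegreePrimesPolyBounded

end Summit.ABC.ABC.Theses.IsogenyGlueCongruence

namespace Summit.ABC.ABC.Theorems

open Summit.ABC.ABC.Theses.IsogenyGlueCongruence

/-- **`DegreePrimesOfCongruenceBound` holds** (route `IsogenyGlueCongruence`, item stmt-ABC-14897):
the torsion-sharing prime bound `K = TorsionSharingPrimeBound` together with its modular input
`DegreePrimeCongruence` gives crux A, `DegreePrimesPolyBounded`, with exponent `2κ` and constant
`max C 0 + 163` built from the constants `κ ≥ 0`, `C` of `K`.  Proof: for `W` semistable take the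
datum `D` of `DegreePrimeCongruence`; a prime `ℓ ∣ deg D` is either `≤ 163 ≤ (max C 0 + 163) · N^(2κ)`
(`N ≥ 1`), or `K` applied to the congruent newform `g` of level `M ∣ N` gives
`ℓ ≤ C · (M · N)^κ ≤ max C 0 · (N · N)^κ = max C 0 · N^(2κ)`. -/
theorem degreePrimesOfCongruenceBound_proof :
    Summit.ABC.ABC.Theses.IsogenyGlueCongruence.DegreePrimesOfCongruenceBound := by
  unfold Summit.ABC.ABC.Theses.IsogenyGlueCongruence.DegreePrimesOfCongruenceBound
    Summit.ABC.ABC.Theses.IsogenyGlueCongruence.DegreePrimesPolyBounded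
  intro hK hCong
  obtain ⟨κ, C, hκ, hK⟩ := hK
  refine ⟨2 * κ, max C 0 + 163, ?_⟩
  intro W _ _ _ hW
  obtain ⟨D, hD⟩ := hCong W hW
  refine ⟨D, fun ℓ hℓ hℓD ↦ ?_⟩
  -- Bookkeeping on the conductor `N ≥ 1`.
  set N : ℝ := (W.conductorNorm ℤ : ℝ) with hNdef
  have hN1 : (1 : ℝ) ≤ N := by
    have h : 1 ≤ W.conductorNorm ℤ := NeZero.one_le
    rw [hNdef]
    exact_mod_cast h
  have hN0 : (0 : ℝ) ≤ N := zero_le_one.trans hN1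
  have h2κ : (0 : ℝ) ≤ 2 * κ := by positivity
  have hpow1 : (1 : ℝ) ≤ N ^ (2 * κ) := Real.one_le_rpow hN1 h2κ
  have hpow0 : (0 : ℝ) ≤ N ^ (2 * κ) := Real.rpow_nonneg hN0 _
  have hC0 : (0 : ℝ) ≤ max C 0 := le_max_right _ _
  have hCA : max C 0 ≤ max C 0 + 163 := by norm_num
  rcases hD ℓ hℓ hℓD with h163 | ⟨M, hM, g, hMN, hg0, hgW, R, F, hF, hchar, φ, hg, hφ⟩
  · -- Case 1: `ℓ ≤ 163`.
    have h163' : (ℓ : ℝ) ≤ 163 := by exact_mod_cast h163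
    calc (ℓ : ℝ) ≤ 163 := h163'
      _ ≤ (max C 0 + 163) * 1 := by rw [mul_one]; linarith
      _ ≤ (max C 0 + 163) * N ^ (2 * κ) := mul_le_mul_of_nonneg_left hpow1 (by linarith)
  · -- Case 2: `ℓ` is a congruence prime of `f_W` with a newform `g` of level `M ∣ N`.
    have hK1 : (ℓ : ℝ) ≤ C * ((M : ℝ) * N) ^ κ := hK W hW M g hg0 hgW ℓ hℓ R F φ hg hφ
    have hMN' : (M : ℝ) ≤ N := by
      have h : M ≤ W.conductorNorm ℤ := Nat.le_of_dvd (Nat.pos_of_ne_zero (NeZero.ne _)) hMN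
      rw [hNdef]
      exact_mod_cast h
    have hbase0 : (0 : ℝ) ≤ (M : ℝ) * N := mul_nonneg (Nat.cast_nonneg _) hN0
    have hbase : (M : ℝ) * N ≤ N * N := mul_le_mul_of_nonneg_right hMN' hN0
    have hrpow : ((M : ℝ) * N) ^ κ ≤ (N * N) ^ κ := Real.rpow_le_rpow hbase0 hbase hκ
    have hNN : (N * N) ^ κ = N ^ (2 * κ) := by
      rw [Real.rpow_mul hN0, Real.rpow_two, sq]
    calc (ℓ : ℝ) ≤ C * ((M : ℝ) * N) ^ κ := hK1
      _ ≤ max C 0 * ((M : ℝ) * N) ^ κ :=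
          mul_le_mul_of_nonneg_right (le_max_left _ _) (Real.rpow_nonneg hbase0 κ)
      _ ≤ max C 0 * (N * N) ^ κ := mul_le_mul_of_nonneg_left hrpow hC0
      _ = max C 0 * N ^ (2 * κ) := by rw [hNN]
      _ ≤ (max C 0 + 163) * N ^ (2 * κ) := mul_le_mul_of_nonneg_right hCA hpow0

end Summit.ABC.ABC.Theorems
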